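import Summits.HodgeConjecture.HodgeConjecture.Theorems.F0LD2ThetaTensorClasses
import HarnessLib

/-!
# Crux `HLiu418`, line LD2 (organ B₂) — KERNEL KIT, finite side (2∕2): THE FINITE THETA INTERTWINER `ω(μ, ε_a, χ)_f ⟶ P_f` along an ABSTRACT adelic
# transport `ιA` (abstract-`ιA` twin of ★ `Liu2021.ThetaLiftFromLineFinIntertwiner` §2, over ★ `F0LD2ThetaTensorClasses`)

Cell hodgecm-mathlib (D-0151), FLOOR 0; crux item `HLiu418` = stmt-HodgeConjecture-24832; half-A line LD2 (socket `stub_S1b_facts`), organ B₂ `ThetaFinComponent₂`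
(skeleton of LD2-plan (g0)).  Seat LD2-p02 (g0).  THEOREMS ONLY (no `def`, no instance, no notation, no named fact, no `sorry`); `--supports
stmt-HodgeConjecture-24832 --as helper`.  HC_CM is proved only modulo the 7 printed citations (2 remaining: hLiu418, h413) until rung 0 closes; this file
discharges nothing printed.

SETTING = ★ `F0LD1ThetaTransportKit` (LD1-p01 (g0)): ANY transport `ιA : U(H)(𝔸_{L⁺}) →* U(diag dV)(𝔸_{L⁺})` with `hιA : Continuous ιA ∧ (range toAdelic ↦ range
toAdelic)`; the two finite-equivariance statements additionally take `hιAf : ιA (1, k) = (1, (ιA (1,k))_f)` («`ιA` carries finite-adelic elements to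
finite-adelic elements» — for the PINNED transport of the LD organs this is ★ `F0LD2FrameTransportPin.pin_finAdelicToAdelic` + ★ `finPart_finAdelicToAdelic`,
with `(ιA (1,k))_f = (finAdelicCongr … g ht hg).symm k`).  Statements and proofs are the ★ ones with `cmAdelicFrameTransport L N H dV g hg ↦ ιA` (same
names, this namespace); rank-generic `N`.

* (★ `FinIntertwiner` §2, over file 1∕2's linearity ∕ equivariance ∕ covariance) **`exists_intertwiningMap_rhoAtLine_finRep`** — the finite theta intertwiner `θ̄_{Φ_∞} : rhoAtLine … (finPart ∘ ιA ∘ (1,·)) a χ ⟶ P.finRep`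
  with `θ̄_{Φ_∞} (mk Φ_f) = pr_P [Θ̃_{R_e E(Φ_∞ ⊗ Φ_f)}(charCM χ̃) ∘ ιA]`.

## References
* [Liu2021] Y. Liu, Camb. J. Math. 9 (2021) = arXiv:2102.11518, proof of Prop. 4.13 Case 1 (l. 2131–2137, p. 48); Def. 4.11; App. D §D.1 Step 3 (l. 5221).
* [Rallis1984] S. Rallis, Compositio Math. 51 (1984), proof of Thm. 1.2.2 p. 356.  [MoeglinVignerasWaldspurger1987] LNM 1291, Chap. 3 IV.
* [Weil1964] A. Weil, Acta Math. 111 (1964), Chap. III n° 37–38, n° 41 Thm 6.  [BorelJacquet1979] PSPM 33.1, §4.1, §4.6.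
* [GelbartRogawski1991] S. Gelbart, J. Rogawski, Invent. Math. 105 (1991), §3.2 p. 457.  [FleigEtAl2018] CUP (2018), §12.3 Def. 12.5.
-/

set_option autoImplicit false
-- the mandated namespace has the single-problem summit's repeated segment (`HodgeConjecture.HodgeConjecture`)
set_option linter.dupNamespace false

noncomputable section

open NumberField MeasureTheory IsDedekindDomain
open scoped Matrix Kronecker ComplexOrder ENNReal SchwartzMap TensorProduct Classical

namespace Summit.HodgeConjecture.HodgeConjecture.Cruxes.HLiu418.F0LD2ThetaFinIntertwiner

open _root_.MeasureTheory
open Literature.NumberTheory.Automorphic Literature.NumberTheory.Automorphic.UnitaryGroup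
open Literature.NumberTheory.Automorphic.UnitaryGroup.CotangentForms
open Literature.NumberTheory.Automorphic.IdeleClassGroup
open Literature.NumberTheory.Automorphic.Liu2021
open Literature.NumberTheory.Automorphic.Liu2021.Def411WeilCarriers
open Literature.NumberTheory.Automorphic.Liu2021.Def411WeilCarriersDoubling
open Literature.NumberTheory.GelbartRogawski1991 Literature.NumberTheory.GelbartRogawski1991.UnitaryDualPair
open Literature.NumberTheory.GelbartRogawski1991.UnitaryDualPair.WeilCoinv
open Literature.NumberTheory.Weil1964
open Literature.RepresentationTheory Literature.RepresentationTheory.Liu2021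
open Literature.RepresentationTheory.CompactGroups
open Literature.RepresentationTheory.HeisenbergGroup
open Summit.HodgeConjecture.HodgeConjecture.Cruxes.HLiu418.F0LD1ThetaTransportKit

open Summit.HodgeConjecture.HodgeConjecture.Cruxes.HLiu418.F0LD2ThetaTensorClasses

/-! ## The finite theta intertwiner (★ `ThetaLiftFromLineFinIntertwiner` §2) -/

section Intertwiner

variable (L : Type) [Field L] [NumberField L] [IsCMField L] (N : ℕ) (H : Matrix (Fin N) (Fin N) L)
  {n' : ℕ} (e₁ : Fin N × Fin 1 ≃ Fin n') (dV : Fin N → L) (hdV : ∀ i, IsCMField.complexConj L (dV i) = dV i)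
  (hdV0 : ∀ i, dV i ≠ 0)
  (ιA : (adelicGroupData (↥(maximalRealSubfield L)) L (IsCMField.complexConj L) N H).Adelic →* ↥(UnitaryGroup.adelic (↥(maximalRealSubfield L)) L (IsCMField.complexConj L) N (Matrix.diagonal dV)))
  (hιA : Continuous ιA ∧ ∀ ⦃γ : (adelicGroupData (↥(maximalRealSubfield L)) L (IsCMField.complexConj L) N H).Adelic⦄,
    γ ∈ (UnitaryGroup.toAdelic (↥(maximalRealSubfield L)) L (IsCMField.complexConj L) N H).range →
      ιA γ ∈ (UnitaryGroup.toAdelic (↥(maximalRealSubfield L)) L (IsCMField.complexConj L) N (Matrix.diagonal dV)).range)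
  (μ : Literature.NumberTheory.Automorphic.IdeleClassGroup L →ₜ* Circle) (hμ : IsConjugateSymplectic L μ) (a : (↥(maximalRealSubfield L))ˣ)
  (hρ : HasThetaMajorants fun
      (p : ↥(UnitaryGroup.adelic (↥(maximalRealSubfield L)) L (IsCMField.complexConj L) N (Matrix.diagonal dV)) × ↥(UnitaryGroup.adelic (↥(maximalRealSubfield L)) L (IsCMField.complexConj L) 1 (JW (↥(maximalRealSubfield L)) L a))) (Φ : piSchwartzBruhat (↥(maximalRealSubfield L)) (Fin n')) =>
        pairRep (↥(maximalRealSubfield L)) L (IsCMField.complexConj L) N 1 e₁ (Matrix.diagonal dV) (JW (↥(maximalRealSubfield L)) L a)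
          (chiSplittingLine L e₁ dV hdV hdV0 (toHeckeCharacter L μ) (isUnitary_toHeckeCharacter L μ)
            ((isOscillatorChar_toHeckeCharacter_iff μ).mpr hμ) (TW (↥(maximalRealSubfield L)) a)
            (isUnit_det_TW (↥(maximalRealSubfield L)) a) (JW (↥(maximalRealSubfield L)) L a) (JW_eq (↥(maximalRealSubfield L)) L a))
          p Φ)
  [CompactSpace (↥(UnitaryGroup.adelic (↥(maximalRealSubfield L)) L (IsCMField.complexConj L) N (Matrix.diagonal dV)) ⧸ (UnitaryGroup.toAdelic (↥(maximalRealSubfield L)) L (IsCMField.complexConj L) N (Matrix.diagonal dV)).range)] [MeasurableSpace (↥(UnitaryGroup.adelic (↥(maximalRealSubfield L)) L (IsCMField.complexConj L) 1 (JW (↥(maximalRealSubfield L)) L a)) ⧸ (UnitaryGroup.toAdelic (↥(maximalRealSubfield L)) L (IsCMField.complexConj L) 1 (JW (↥(maximalRealSubfield L)) L a)).range)] [BorelSpace (↥(UnitaryGroup.adelic (↥(maximalRealSubfield L)) L (IsCMField.complexConj L) 1 (JW (↥(maximalRealSubfield L)) L a)) ⧸ (UnitaryGroup.toAdelic (↥(maximalRealSubfield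 L)) L (IsCMField.complexConj L) 1 (JW (↥(maximalRealSubfield L)) L a)).range)] (μW : Measure (↥(UnitaryGroup.adelic (↥(maximalRealSubfield L)) L (IsCMField.complexConj L) 1 (JW (↥(maximalRealSubfield L)) L a)) ⧸ (UnitaryGroup.toAdelic (↥(maximalRealSubfield L)) L (IsCMField.complexConj L) 1 (JW (↥(maximalRealSubfield L)) L a)).range)) [IsFiniteMeasure μW] [SMulInvariantMeasure ↥(UnitaryGroup.adelic (↥(maximalRealSubfield L)) L (IsCMField.complexConj L) 1 (JW (↥(maximalRealSubfield L)) L a)) (↥(UnitaryGroup.adelic (↥(maximalRealSubfield L)) L (IsCMField.complexConj L) 1 (JW (↥(maximalRealSubfield L)) L a)) ⧸ (UnitaryGroup.toAdelic (↥(maximalRealSubfield L)) L (IsCMField.complexConj L) 1 (JW (↥(maximalRealSubfield L)) L a)).range) μW]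
  (φ : 𝓢(((Fin N × Fin 1) → NumberField.mixedEmbedding.mixedSpace ↥(maximalRealSubfield L)), ℂ))
  {μA : Measure (adelicGroupData (↥(maximalRealSubfield L)) L (IsCMField.complexConj L) N H).automorphicQuotient}
  [(adelicGroupData (↥(maximalRealSubfield L)) L (IsCMField.complexConj L) N H).IsAutomorphicMeasure μA]
  [CompactSpace (adelicGroupData (↥(maximalRealSubfield L)) L (IsCMField.complexConj L) N H).automorphicQuotient]
  (P : DiscreteAutomorphicRep (adelicGroupData (↥(maximalRealSubfield L)) L (IsCMField.complexConj L) N H) μA)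
  (χ : Chi (↥(maximalRealSubfield L)) L (IsCMField.complexConj L))

include hιA

set_option maxHeartbeats 1600000 in
/-- **THE FINITE THETA INTERTWINER `θ̄_{Φ_∞}` ([Rallis1984] localisation of the global theta lift, on the finite side).**  For the discrete `P` of
`U(H)`, a fixed archimedean Schwartz factor `Φ_∞` and `χ ∈ Chi`: the `ℂ`-linear map `Φ_f ↦ pr_P [Θ̃_{R_e E(Φ_∞ ⊗ Φ_f)}(charCM χ̃) ∘ ιA]`
(`pr_P` = orthogonal projection onto `P ⊂ L²([U(H)])`, `χ̃ = chiQuot a χ`) kills `ω_f(1,u)Φ_f − χ_W(u)Φ_f` (`toLp_lineThetaLift_tensor_finPairRep_one`), hence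
factors through the `χ_W`-coinvariants `omegaAtLine … a χ` of the finite Weil representation (★ `WeilCoinv.weilCoinvLift`), and the factored map is
`U(H)(𝔸_{L⁺,f})`-EQUIVARIANT from `rhoAtLine … ιV a χ` (canonical finite transport `ιV = finPart ∘ cmAdelicFrameTransport ∘ finAdelicToAdelic`) to
`P.finRep` (`rightRegular_finAdelicToAdelic_toLp_lineThetaLift_tensor` + ★ `orthogonalProjectionOnto_rightRegular`): an intertwiner `θ̄_{Φ_∞}` with
`θ̄_{Φ_∞} (mk Φ_f) = pr_P [Θ̃_{R_e E(Φ_∞ ⊗ Φ_f)}(charCM χ̃) ∘ ιA]`.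
[cite: Liu2021, proof of Prop. 4.13 Case 1 (l. 2136–2137, p. 48); App. D §D.1 Step 3 (l. 5221)] [cite: Rallis1984, Thm. 1.2.2 proof p. 356]
[cite: MoeglinVignerasWaldspurger1987, Chap. 3 IV] -/
theorem exists_intertwiningMap_rhoAtLine_finRep
    (hιAf : ∀ k, ιA (finAdelicToAdelic (↥(maximalRealSubfield L)) L (IsCMField.complexConj L) N H k) =
      finAdelicToAdelic (↥(maximalRealSubfield L)) L (IsCMField.complexConj L) N (Matrix.diagonal dV)
        (finPart (↥(maximalRealSubfield L)) L (IsCMField.complexConj L) N (Matrix.diagonal dV)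
          (ιA (finAdelicToAdelic (↥(maximalRealSubfield L)) L (IsCMField.complexConj L) N H k)))) :
    haveI := normal_range_toAdelic_JW L a
    ∃ θ : (rhoAtLine (↥(maximalRealSubfield L)) L (IsCMField.complexConj L) N e₁ (Matrix.diagonal dV) (complexConj_imagUnit L)
          (imagUnit_ne_zero L) (imagUnit_mul_self L) (realDiagonal_isSymm L dV hdV) (isUnit_det_realDiagonal L dV hdV hdV0)
          (realDiagonal_map L dV hdV).symm
          (fun b => isCompatible_chiSplittingLine L e₁ dV hdV hdV0 (toHeckeCharacter L μ) (isUnitary_toHeckeCharacter L μ)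
            ((isOscillatorChar_toHeckeCharacter_iff μ).mpr hμ) (TW (↥(maximalRealSubfield L)) b) (isSymm_TW (↥(maximalRealSubfield L)) b)
            (isUnit_det_TW (↥(maximalRealSubfield L)) b) (JW (↥(maximalRealSubfield L)) L b) (JW_eq (↥(maximalRealSubfield L)) L b))
          ((finPart (↥(maximalRealSubfield L)) L (IsCMField.complexConj L) N (Matrix.diagonal dV)).comp
            (ιA.comp (finAdelicToAdelic (↥(maximalRealSubfield L)) L (IsCMField.complexConj L) N H)))
          a χ).IntertwiningMap P.finRep,
      ∀ Φf : FinSB (↥(maximalRealSubfield L)) (Fin N × Fin 1),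
        ((θ (TwistedCoinv.mk _ _ Φf) : P.space.toSubmodule) : Lp ℂ 2 μA) =
          P.space.toSubmodule.starProjection
            (MemLp.toLp _ (memLp_toQuotFun_lineThetaLift L N H e₁ dV hdV hdV0 ιA hιA μ hμ a hρ μW
              (piSBReindex (↥(maximalRealSubfield L)) e₁ (piSchwartzBruhatEquiv (↥(maximalRealSubfield L)) (Fin N × Fin 1) (φ ⊗ₜ[ℂ] Φf)))
              (charCM (chiQuot (↥(maximalRealSubfield L)) L (IsCMField.complexConj L) (Algebra.IsQuadraticExtension.finrank_eq_two _ L)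
                (IsCMField.complexConj_ne_one (K := L)) a χ)) μA 2)) := by
  haveI := normal_range_toAdelic_JW L a
  -- the class map `Φ_f ↦ [Θ̃_{R_e E(Φ_∞ ⊗ Φ_f)}(charCM χ̃) ∘ ιA]`, linear in `Φ_f`
  let cls : FinSB (↥(maximalRealSubfield L)) (Fin N × Fin 1) →ₗ[ℂ] Lp ℂ 2 μA :=
    { toFun := fun Φf => MemLp.toLp _ (memLp_toQuotFun_lineThetaLift L N H e₁ dV hdV hdV0 ιA hιA μ hμ a hρ μW
          (piSBReindex (↥(maximalRealSubfield L)) e₁ (piSchwartzBruhatEquiv (↥(maximalRealSubfield L)) (Fin N × Fin 1) (φ ⊗ₜ[ℂ] Φf)))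
          (charCM (chiQuot (↥(maximalRealSubfield L)) L (IsCMField.complexConj L) (Algebra.IsQuadraticExtension.finrank_eq_two _ L)
            (IsCMField.complexConj_ne_one (K := L)) a χ)) μA 2)
      map_add' := fun Φf Φf' => toLp_lineThetaLift_tensor_add L N H e₁ dV hdV hdV0 ιA hιA μ hμ a hρ μW _ φ μA Φf Φf'
      map_smul' := fun c Φf => by
        rw [RingHom.id_apply]
        exact toLp_lineThetaLift_tensor_smul L N H e₁ dV hdV hdV0 ιA hιA μ hμ a hρ μW _ φ μA c Φf }
  -- followed by the orthogonal projection onto `P`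
  let T : FinSB (↥(maximalRealSubfield L)) (Fin N × Fin 1) →ₗ[ℂ] P.space.toSubmodule :=
    (P.space.toSubmodule.orthogonalProjectionOnto : Lp ℂ 2 μA →L[ℂ] P.space.toSubmodule).toLinearMap ∘ₗ cls
  have hT : ∀ Φf, T Φf = P.space.toSubmodule.orthogonalProjectionOnto (cls Φf) := fun _ => rfl
  have hcls : ∀ Φf, cls Φf = MemLp.toLp _ (memLp_toQuotFun_lineThetaLift L N H e₁ dV hdV hdV0 ιA hιA μ hμ a hρ μW
      (piSBReindex (↥(maximalRealSubfield L)) e₁ (piSchwartzBruhatEquiv (↥(maximalRealSubfield L)) (Fin N × Fin 1) (φ ⊗ₜ[ℂ] Φf)))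
      (charCM (chiQuot (↥(maximalRealSubfield L)) L (IsCMField.complexConj L) (Algebra.IsQuadraticExtension.finrank_eq_two _ L)
        (IsCMField.complexConj_ne_one (K := L)) a χ)) μA 2) := fun _ => rfl
  -- `χ_W`-covariance: `T` kills the relation module of the coinvariants
  have hcov : ∀ (u : finAdelic (↥(maximalRealSubfield L)) L (IsCMField.complexConj L) 1 (JW (↥(maximalRealSubfield L)) L a))
      (Φf : FinSB (↥(maximalRealSubfield L)) (Fin N × Fin 1)),
      T (finPairRep (↥(maximalRealSubfield L)) L (IsCMField.complexConj L) N 1 e₁ (Matrix.diagonal dV) (JW (↥(maximalRealSubfield L)) L a)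
          (complexConj_imagUnit L) (imagUnit_ne_zero L) (imagUnit_mul_self L) (realDiagonal_isSymm L dV hdV) (isSymm_TW (↥(maximalRealSubfield L)) a)
          (isUnit_det_realDiagonal L dV hdV hdV0) (isUnit_det_TW (↥(maximalRealSubfield L)) a) (realDiagonal_map L dV hdV).symm
          (JW_eq (↥(maximalRealSubfield L)) L a)
          (isCompatible_chiSplittingLine L e₁ dV hdV hdV0 (toHeckeCharacter L μ) (isUnitary_toHeckeCharacter L μ)
            ((isOscillatorChar_toHeckeCharacter_iff μ).mpr hμ) (TW (↥(maximalRealSubfield L)) a) (isSymm_TW (↥(maximalRealSubfield L)) a)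
            (isUnit_det_TW (↥(maximalRealSubfield L)) a) (JW (↥(maximalRealSubfield L)) L a) (JW_eq (↥(maximalRealSubfield L)) L a))
          (1, u) Φf) =
        ((lineChar (↥(maximalRealSubfield L)) L (IsCMField.complexConj L) a χ.1 u : ℂˣ) : ℂ) • T Φf := by
    intro u Φf
    rw [hT, hT, hcls, hcls, toLp_lineThetaLift_tensor_finPairRep_one L N H e₁ dV hdV hdV0 ιA hιA μ hμ a hρ μW φ μA χ u Φf, map_smul]
  -- `U(H)(𝔸_{L⁺,f})`-equivariance
  have heqv : ∀ (k : finAdelic (↥(maximalRealSubfield L)) L (IsCMField.complexConj L) N H) (Φf : FinSB (↥(maximalRealSubfield L)) (Fin N × Fin 1)),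
      T (finPairRep (↥(maximalRealSubfield L)) L (IsCMField.complexConj L) N 1 e₁ (Matrix.diagonal dV) (JW (↥(maximalRealSubfield L)) L a)
          (complexConj_imagUnit L) (imagUnit_ne_zero L) (imagUnit_mul_self L) (realDiagonal_isSymm L dV hdV) (isSymm_TW (↥(maximalRealSubfield L)) a)
          (isUnit_det_realDiagonal L dV hdV hdV0) (isUnit_det_TW (↥(maximalRealSubfield L)) a) (realDiagonal_map L dV hdV).symm
          (JW_eq (↥(maximalRealSubfield L)) L a)
          (isCompatible_chiSplittingLine L e₁ dV hdV hdV0 (toHeckeCharacter L μ) (isUnitary_toHeckeCharacter L μ)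
            ((isOscillatorChar_toHeckeCharacter_iff μ).mpr hμ) (TW (↥(maximalRealSubfield L)) a) (isSymm_TW (↥(maximalRealSubfield L)) a)
            (isUnit_det_TW (↥(maximalRealSubfield L)) a) (JW (↥(maximalRealSubfield L)) L a) (JW_eq (↥(maximalRealSubfield L)) L a))
          ((finPart (↥(maximalRealSubfield L)) L (IsCMField.complexConj L) N (Matrix.diagonal dV)
            (ιA (finAdelicToAdelic (↥(maximalRealSubfield L)) L (IsCMField.complexConj L) N H k))), 1) Φf) =
        P.finRep k (T Φf) := by
    intro k Φf
    rw [hT, hT, hcls, hcls, DiscreteAutomorphicRep.finRep_apply, ← DiscreteAutomorphicRep.orthogonalProjectionOnto_rightRegular,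
      rightRegular_finAdelicToAdelic_toLp_lineThetaLift_tensor L N H e₁ dV hdV hdV0 ιA hιA μ hμ a hρ μW _ φ μA hιAf k Φf]
  refine ⟨LinearMap.intertwiningMap_of_isIntertwiningMap _ _
      (weilCoinvLift (↥(maximalRealSubfield L)) L (IsCMField.complexConj L) N 1 e₁ (Matrix.diagonal dV) (JW (↥(maximalRealSubfield L)) L a)
        (complexConj_imagUnit L) (imagUnit_ne_zero L) (imagUnit_mul_self L) (realDiagonal_isSymm L dV hdV) (isSymm_TW (↥(maximalRealSubfield L)) a)
        (isUnit_det_realDiagonal L dV hdV hdV0) (isUnit_det_TW (↥(maximalRealSubfield L)) a) (realDiagonal_map L dV hdV).symm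
        (JW_eq (↥(maximalRealSubfield L)) L a) (lineChar (↥(maximalRealSubfield L)) L (IsCMField.complexConj L) a χ.1)
        (isCompatible_chiSplittingLine L e₁ dV hdV hdV0 (toHeckeCharacter L μ) (isUnitary_toHeckeCharacter L μ)
          ((isOscillatorChar_toHeckeCharacter_iff μ).mpr hμ) (TW (↥(maximalRealSubfield L)) a) (isSymm_TW (↥(maximalRealSubfield L)) a)
          (isUnit_det_TW (↥(maximalRealSubfield L)) a) (JW (↥(maximalRealSubfield L)) L a) (JW_eq (↥(maximalRealSubfield L)) L a))
        T hcov) (fun k x => ?_), fun Φf => ?_⟩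
  · -- on generators `mk Φ_f`: `θ̄ (ρ(k) mk Φ_f) = θ̄ (mk (ω_f(ιV k, 1) Φ_f)) = T (ω_f(ιV k, 1) Φ_f)` definitionally
    obtain ⟨Φf, rfl⟩ := TwistedCoinv.mk_surjective _ _ x
    exact heqv k Φf
  · show ((T Φf : P.space.toSubmodule) : Lp ℂ 2 μA) = _
    rw [hT, hcls, Submodule.coe_orthogonalProjectionOnto_apply]

end Intertwiner

end Summit.HodgeConjecture.HodgeConjecture.Cruxes.HLiu418.F0LD2ThetaFinIntertwiner

end
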